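import Mathlib.Analysis.Complex.ExponentialBounds

/-!
# NE9LinSizeCurrencyBudgetKP — N2-ter §B: the N2-bis budget RE-RUN on the d-currency KP ∕ pin side (binder shapes of crew row
(w13) part 1b `NE9LinSizeKP` and part 2 B-i `NE9LinSizePinned`, which the d-currency END face E5′ composes): the rate budget is
ADDITIVE and ATTAINED, the fading product carries NO exponential in κ, a, a′, a″ (cell `pub-balaban`, node U3 ∕ spine estimate NE9,
rung (B)+1 on a FIXED finite T⁴; NE9 formalisation crew, unit `b2b-balaban-t4-ne9-formalise-leaf-01` gen 2; companion of N2-bis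
`NE9CubeCurrencyBudget` and N2-ter §A `NE9LinSizeCurrencyBudget`)

HONEST FRAMING (T4-DAG PAGE 1).  Rung (B)+1 on a fixed finite torus; NOT infinite volume, NOT the mass gap, NOT Clay.  NE9 is
NOT PRINTED and NOT proved; this module is OUR OWN bookkeeping (pure real arithmetic), asserts nothing about Bałaban's objects,
re-wires no END face and introduces no `def`.  HONEST DEPENDENCY: continuum YM on T⁴ ⇐ BetaPertH ∧ nine spine estimates (0/9
proved); BetaPertH ⇐ (D1) ∧ (D4) ∧ CAP+tail; G-an2-4 gates asym, D1 and NE2/3/4.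

WHAT IS RECORDED.  Finding F-ne9leaf01-1 (journal l.6309; ENDORSED by the row owner, l.6787 (2)) located two costs of the
CUBE-COUNT dischargers of the NE9 END binders A1 (KP clause), G1 (`DecayExtract`), G2 (`PinBudget`): (R) the delivered rate is
the (2.38)-TYPE rate DIVIDED by `2^ν` (N2-bis `rate_budget`: `κ ≤ a′/2^ν − a₁ − 1 − log(2D)`), (P) the fading product carries
`e^{a(1−2^{−ν}) + a′(1−2^{−ν}) + κ}` (N2-bis `fadingProduct_lb`).  Crew row (w13) (repair item NE9-F8) re-discharges them in Bałaban's
linear size; its binders read (shapes verbatim from the tree — `NE9LinSizeKP.kpClause_of_linSizeDecay` ∕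
`twoPointKP_of_avgEvalExpLinear_box_linSizeDecay`, `NE9LinSizeKP.pinBudget_linSize`, `NE9LinSizePinned.pin_of_linSizeDecay`):
* `hrate  : 2 ^ ν * log 2 + log (8 * ν) ≤ a' - a'' - 2 ^ ν * a₁`                          (ADDITIVE rate condition),
* `hsmall : 2 * ((D + 1) * ε * exp (a'' * (ν + 1) + 2 ^ ν * a₁) * 2 ^ (ν + 1 + 2 ^ ν)) ≤ a₁`  (KP smallness; `e^{a″(ν+1)}` = print's
  `e^{5κ}` at `ν = 4`, [II] p. 18 «… exp 5κ ≤ 1»),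
* `hcmp   : κ * C.d X ≤ a'' * linSize (cubes X)` (so `κ ≤ a''` on carriers reading `C.d = d`), pin envelope `B = a₁·e^{−a″(ν+1)}`,
* `hliplb : α4 * 2 ^ (ν + 1 + 2 ^ ν) ≤ lip`, `lip ≤ lipbar`                                  (lip side, B-i).
From these SHAPES alone (hypotheses copied token for token):
§1 (R′) `κ ≤ a′ − (2^ν·log 2 + log 8ν) − 2^ν·a₁` (`rate_budget_lin`) — ADDITIVE — and this value is ATTAINED
   (`rate_budget_lin_attained`); T⁴: `κ ≤ a′ − 21·log 2 − 16a₁`, `> a′ − 14.557 − 16a₁`, above the cube-currency CEILING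
   `a′/16 − 3.77 − a₁` of N2-bis as soon as `a′ > 11.51 + 16a₁` (`cube_ceiling_lt_lin_budget_T4`); in print's letters (located
   dictionary `a′ ↔ (1−8δ)(L/2)κ = (L+8)κ/10`, `δ = (1−2/L)/10`): the FULL printed rate for EVERY odd `L ≥ 13` once
   `κ ≥ 13.24 + (160/11)a₁` (`full_rate_L13`; with an absorbed shift `16·log 2`: `κ ≥ 23.33 + (160/11)a₁`), against N2-bis'
   `rate_fraction_ge_one_iff` (cube currency: full rate only for `L ≥ 152`).
§2 (P′) `8(D+1)·(2^(ν+1+2^ν))²·e^{2^ν a₁}·α4·ε·τ̄ ≤ 4·lipbar·B·τ̄` (`fadingProduct_lb_lin`): fading REQUIRES the POLYNOMIAL smallness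
   `8(D+1)·(2^(ν+1+2^ν))²·α4·ε·τ̄ < 1 − ω` (`fade_necessary_lin`; T⁴: `72·2^42·α4·ε·τ̄ < 1 − ω`) — NO `e^{κ}`, `e^{a}`, `e^{a′}`;
   and conversely (`fade_sufficient_lin`) the binders `hsmall`, `hliplb`, `hlipb` are JOINTLY satisfiable WITH fading under
   `8e(D+1)(2^(ν+1+2^ν))²·α4·ε·τ̄ < 1 − ω` and the KP-type smallness `2^{ν+1}e(D+1)2^(ν+1+2^ν)·ε·e^{a″(ν+1)} ≤ 1` — print's own
   shape «2E₀ε₁C₁α₄⁻¹α₆⁻¹M^q exp C₂κ₁ exp 5κ ≤ 1» (p. 18) with `5 = ν + 1`: the break-even `X(33) < 5 < X(35)` of N2-bis ∕ N2-ter §A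
   is GONE — no `L`-dependent exponent competes with print's `e^{−5κ}`.
CENSUS MEANING.  Through the d-currency dischargers the located costs (R)∕(P) of F-ne9leaf01-1 disappear: leaf-10's N2 verdict
(«fading is not an additional ε₁-smallness», `NE9FadingArithmetic`) now holds ALSO through the tree's typed dischargers, up to
polynomial constants (`2^42`-type on T⁴, symbolic per c6) and the printed `e^{5κ}`-weighted KP smallness.  What E5′ (stage B-ii,
`NE9LinSizeEnd`, another seat) displays is the composition of exactly these binders; if its display differs, a §C follows.

References (TYPE locators only; nothing printed is a hypothesis): T. Bałaban, CMP **116** (1988) 1–22 [Balaban1988RG2Cluster],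
(1.26) p. 8, (2.27) p. 18, p. 18 «exp 5κ ≤ 1», (2.30) p. 18, Lemma 3 (2.38) p. 20, (2.40)–(2.41) p. 21; CMP **109** (1987)
[Balaban1987RG1] p. 251, p. 257; R. Kotecký, D. Preiss, CMP **103** (1986).
-/

noncomputable section

namespace Summit.QuantumFields.BalabanUV.T4Continuum.NE9LinSizeCurrencyBudgetKP

open Real

/-! ## §1 (R′) The ADDITIVE rate budget of the d-currency KP ∕ pin binders, and its attainment -/

/-- **(R′) RATE BUDGET, d-CURRENCY (kernel).**  `hrate : 2^ν·log 2 + log(8ν) ≤ a′ − a″ − 2^ν·a₁` and `κ ≤ a″` (the comparability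
`hcmp` on carriers reading `C.d X = d(cubes X)`) give `κ ≤ a′ − (2^ν·log 2 + log 8ν) − 2^ν·a₁` — the (2.38)-TYPE rate MINUS an
additive constant (compare N2-bis `rate_budget`: `a′/2^ν − …`). [folklore] -/
theorem rate_budget_lin {ν : ℕ} {a' a'' a₁ κ : ℝ}
    (hrate : (2:ℝ) ^ ν * Real.log 2 + Real.log (8 * ν) ≤ a' - a'' - 2 ^ ν * a₁) (hκ : κ ≤ a'') :
    κ ≤ a' - ((2:ℝ) ^ ν * Real.log 2 + Real.log (8 * ν)) - 2 ^ ν * a₁ := by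
  linarith

/-- **(R′) IS ATTAINED**: for `a′`, `a₁` with a nonnegative budget, the choice `a″ = κ = a′ − (2^ν·log 2 + log 8ν) − 2^ν·a₁` meets
`hrate` (with equality), `κ ≤ a″` and `0 ≤ a″` (the sign `decayExtract_linSize` wants). [folklore] -/
theorem rate_budget_lin_attained {ν : ℕ} {a' a₁ : ℝ}
    (h : 0 ≤ a' - ((2:ℝ) ^ ν * Real.log 2 + Real.log (8 * ν)) - 2 ^ ν * a₁) :
    ∃ a'' κ : ℝ, (2:ℝ) ^ ν * Real.log 2 + Real.log (8 * ν) ≤ a' - a'' - 2 ^ ν * a₁ ∧ κ ≤ a'' ∧ 0 ≤ a'' ∧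
      κ = a' - ((2:ℝ) ^ ν * Real.log 2 + Real.log (8 * ν)) - 2 ^ ν * a₁ :=
  ⟨a' - ((2:ℝ) ^ ν * Real.log 2 + Real.log (8 * ν)) - 2 ^ ν * a₁, _, by linarith, le_rfl, h, rfl⟩

/-- **(R′) ON T⁴** (`ν = 4`): `κ ≤ a′ − 21·log 2 − 16·a₁`. [folklore] -/
theorem rate_budget_lin_T4 {a' a'' a₁ κ : ℝ}
    (hrate : (2:ℝ) ^ (4:ℕ) * Real.log 2 + Real.log (8 * ((4:ℕ):ℝ)) ≤ a' - a'' - 2 ^ (4:ℕ) * a₁) (hκ : κ ≤ a'') :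
    κ ≤ a' - 21 * Real.log 2 - 16 * a₁ := by
  have h32 : Real.log (8 * ((4:ℕ):ℝ)) = 5 * Real.log 2 := by
    rw [show (8 * ((4:ℕ):ℝ)) = 2 ^ 5 by norm_num, Real.log_pow]; norm_num
  have e : (2:ℝ) ^ (4:ℕ) = 16 := by norm_num
  rw [h32, e] at hrate
  linarith

/-- the attained T⁴ budget `a′ − 21·log 2 − 16a₁` exceeds `a′ − 14.557 − 16a₁`. [folklore] -/
theorem lin_budget_T4_gt (a' a₁ : ℝ) : a' - 14.557 - 16 * a₁ < a' - 21 * Real.log 2 - 16 * a₁ := by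
  have := Real.log_two_lt_d9
  linarith

/-- **COMPARISON ON T⁴: the d-currency budget lies ABOVE the cube-currency CEILING** `a′/16 − 3.77 − a₁` of N2-bis
`rate_budget_T4` as soon as `a′ > 11.51 + 16a₁`. [folklore] -/
theorem cube_ceiling_lt_lin_budget_T4 {a' a₁ : ℝ} (h : 11.51 + 16 * a₁ < a') :
    a' / 16 - 3.77 - a₁ < a' - 14.557 - 16 * a₁ := by
  linarith

/-- **(R′) IN PRINT'S LETTERS: when does the FULL printed rate fit?**  With the located dictionary `a′ = (L+8)κ/10 − s` (`s ≥ 0` an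
absorbed additive shift) and threshold-plus-size constant `c + 16a₁`: `κ ≤ a′ − c − 16a₁ ↔ c + 16a₁ + s ≤ (L−2)κ/10`. [folklore] -/
theorem full_rate_iff (L κ a₁ s c : ℝ) :
    κ ≤ ((L + 8) / 10 * κ - s) - c - 16 * a₁ ↔ c + 16 * a₁ + s ≤ (L - 2) / 10 * κ := by
  constructor <;> intro h <;> linarith

/-- **FULL RATE AT PRINT'S SMALLEST `L = 13`, no shift**: every `κ ≥ 13.24 + (160/11)·a₁` fits (`1.1κ ≥ 21·log 2 + 16a₁`).
Cube currency (N2-bis `rate_fraction_ge_one_iff`): never below `L = 152`. [folklore] -/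
theorem full_rate_L13 {κ a₁ : ℝ} (hκ : 13.24 + 160 / 11 * a₁ ≤ κ) :
    κ ≤ (13 + 8) / 10 * κ - 21 * Real.log 2 - 16 * a₁ := by
  have := Real.log_two_lt_d9
  linarith

/-- **FULL RATE AT `L = 13` with the shift `s = 16·log 2`** (the price of absorbing a polynomial volume factor `2^{#γ′}` into the
(2.38)-TYPE decay through `#γ′ ≤ 16(d(γ′)+1)`): every `κ ≥ 23.33 + (160/11)·a₁` fits (`1.1κ ≥ 37·log 2 + 16a₁`). [folklore] -/
theorem full_rate_L13_shifted {κ a₁ : ℝ} (hκ : 23.33 + 160 / 11 * a₁ ≤ κ) :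
    κ ≤ ((13 + 8) / 10 * κ - 16 * Real.log 2) - 21 * Real.log 2 - 16 * a₁ := by
  have := Real.log_two_lt_d9
  linarith

/-! ## §2 (P′) The fading product of the d-currency dischargers: no exponential in κ, a, a′, a″ -/

/-- **PIN ENVELOPE FROM THE KP SMALLNESS (kernel).**  A smallness of the shape `t·((D+1)·ε·e^{a″(ν+1) + r}·2^(ν+1+2^ν)) ≤ a₁`
(`t = 2`, `r = 2^ν·a₁` in `twoPointKP_of_avgEvalExpLinear_box_linSizeDecay`; `t = 1`, `r = 2^ν(a₁+a₀)` in `kpClause_of_linSizeDecay`)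
bounds the pin envelope `B = a₁·e^{−a″(ν+1)}` of `pinBudget_linSize` from below WITHOUT `e^{a″}`:
`t·(D+1)·2^(ν+1+2^ν)·e^{r}·ε ≤ a₁·e^{−a″(ν+1)}`. [folklore] -/
theorem envelope_lb {ν D : ℕ} {a'' a₁ ε r t : ℝ}
    (hsmall : t * (((D : ℝ) + 1) * ε * Real.exp (a'' * (ν + 1) + r) * 2 ^ (ν + 1 + 2 ^ ν)) ≤ a₁) :
    t * ((D : ℝ) + 1) * 2 ^ (ν + 1 + 2 ^ ν) * Real.exp r * ε ≤ a₁ * Real.exp (-(a'' * (ν + 1))) := by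
  have hpos : 0 < Real.exp (-(a'' * (ν + 1))) := Real.exp_pos _
  have h := mul_le_mul_of_nonneg_right hsmall hpos.le
  have e : Real.exp (a'' * (ν + 1) + r) * Real.exp (-(a'' * (ν + 1))) = Real.exp r := by
    rw [← Real.exp_add]; congr 1; ring
  calc t * ((D : ℝ) + 1) * 2 ^ (ν + 1 + 2 ^ ν) * Real.exp r * ε
      = t * (((D : ℝ) + 1) * ε * (Real.exp (a'' * (ν + 1) + r) * Real.exp (-(a'' * (ν + 1)))) *
          2 ^ (ν + 1 + 2 ^ ν)) := by rw [e]; ring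
    _ = t * (((D : ℝ) + 1) * ε * Real.exp (a'' * (ν + 1) + r) * 2 ^ (ν + 1 + 2 ^ ν)) *
          Real.exp (-(a'' * (ν + 1))) := by ring
    _ ≤ a₁ * Real.exp (-(a'' * (ν + 1))) := h

/-- the envelope bound for the `twoPointKP_…_linSizeDecay` shape (`t = 2`, `r = 2^ν·a₁`). [folklore] -/
theorem envelope_lb_twoPoint {ν D : ℕ} {a'' a₁ ε : ℝ}
    (hsmall : 2 * (((D : ℝ) + 1) * ε * Real.exp (a'' * (ν + 1) + 2 ^ ν * a₁) * 2 ^ (ν + 1 + 2 ^ ν)) ≤ a₁) :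
    2 * ((D : ℝ) + 1) * 2 ^ (ν + 1 + 2 ^ ν) * Real.exp (2 ^ ν * a₁) * ε ≤ a₁ * Real.exp (-(a'' * (ν + 1))) :=
  envelope_lb hsmall

/-- the envelope bound for the `kpClause_of_linSizeDecay` shape (`t = 1`, `r = 2^ν(a₁ + a₀)`). [folklore] -/
theorem envelope_lb_kpClause {ν D : ℕ} {a'' a₁ a₀ ε : ℝ}
    (hsmall : ((D : ℝ) + 1) * ε * Real.exp (a'' * (ν + 1) + 2 ^ ν * (a₁ + a₀)) * 2 ^ (ν + 1 + 2 ^ ν) ≤ a₁) :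
    ((D : ℝ) + 1) * 2 ^ (ν + 1 + 2 ^ ν) * Real.exp (2 ^ ν * (a₁ + a₀)) * ε ≤ a₁ * Real.exp (-(a'' * (ν + 1))) := by
  have h := @envelope_lb ν D a'' a₁ ε (2 ^ ν * (a₁ + a₀)) 1 (by rw [one_mul]; exact hsmall)
  rwa [one_mul] at h

/-- **(P′) THE FADING PRODUCT IN d-CURRENCY (kernel).**  Under the binder shapes `hliplb : α4·2^(ν+1+2^ν) ≤ lip ≤ lipbar` (B-i) and
the `twoPointKP` smallness `hsmall`, with the pin envelope `B = a₁·e^{−a″(ν+1)}`: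
`8(D+1)·(2^(ν+1+2^ν))²·e^{2^ν a₁}·α4·ε·τ̄ ≤ 4·lipbar·B·τ̄` — compare N2-bis `fadingProduct_lb`
(`… e^{a(1−2^{−ν}) + a′(1−2^{−ν}) + κ}`) and N2-ter §A `fadingProduct_lb_pinnedLin` (`… e^{a′(1−2^{−ν}) + κ}`): NO exponential in
`κ`, `a`, `a′`, `a″` is left. [folklore] -/
theorem fadingProduct_lb_lin {ν D : ℕ} {a'' a₁ ε α4 lip lipbar τbar : ℝ} (hα4 : 0 ≤ α4) (hε : 0 ≤ ε) (hτbar : 0 ≤ τbar)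
    (hliplb : α4 * 2 ^ (ν + 1 + 2 ^ ν) ≤ lip) (hlipb : lip ≤ lipbar)
    (hsmall : 2 * (((D : ℝ) + 1) * ε * Real.exp (a'' * (ν + 1) + 2 ^ ν * a₁) * 2 ^ (ν + 1 + 2 ^ ν)) ≤ a₁) :
    8 * ((D : ℝ) + 1) * (2 ^ (ν + 1 + 2 ^ ν)) ^ 2 * Real.exp (2 ^ ν * a₁) * α4 * ε * τbar ≤
      4 * lipbar * (a₁ * Real.exp (-(a'' * (ν + 1)))) * τbar := by
  have h1 : α4 * 2 ^ (ν + 1 + 2 ^ ν) ≤ lipbar := hliplb.trans hlipb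
  have h2 := envelope_lb_twoPoint hsmall
  have hx : 0 ≤ α4 * 2 ^ (ν + 1 + 2 ^ ν) := by positivity
  have hy : 0 ≤ 2 * ((D : ℝ) + 1) * 2 ^ (ν + 1 + 2 ^ ν) * Real.exp (2 ^ ν * a₁) * ε := by positivity
  have h12 : α4 * 2 ^ (ν + 1 + 2 ^ ν) * (2 * ((D : ℝ) + 1) * 2 ^ (ν + 1 + 2 ^ ν) * Real.exp (2 ^ ν * a₁) * ε) ≤
      lipbar * (a₁ * Real.exp (-(a'' * (ν + 1)))) := mul_le_mul h1 h2 hy (hx.trans h1)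
  calc 8 * ((D : ℝ) + 1) * (2 ^ (ν + 1 + 2 ^ ν)) ^ 2 * Real.exp (2 ^ ν * a₁) * α4 * ε * τbar
      = 4 * (α4 * 2 ^ (ν + 1 + 2 ^ ν) *
          (2 * ((D : ℝ) + 1) * 2 ^ (ν + 1 + 2 ^ ν) * Real.exp (2 ^ ν * a₁) * ε)) * τbar := by ring
    _ ≤ 4 * (lipbar * (a₁ * Real.exp (-(a'' * (ν + 1))))) * τbar :=
        mul_le_mul_of_nonneg_right (mul_le_mul_of_nonneg_left h12 (by norm_num)) hτbar
    _ = 4 * lipbar * (a₁ * Real.exp (-(a'' * (ν + 1)))) * τbar := by ring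

/-- **(P′) AS A NECESSARY CONDITION: a POLYNOMIAL smallness.**  Fading of the d-currency END rate
(`ω + 4·lipbar·B·τ̄ < 1`, `B = a₁·e^{−a″(ν+1)}`) REQUIRES `8(D+1)·(2^(ν+1+2^ν))²·α4·ε·τ̄ < 1 − ω` — a pure number times `α4·ε·τ̄`.
[folklore] -/
theorem fade_necessary_lin {ν D : ℕ} {a'' a₁ ε α4 lip lipbar τbar ω : ℝ} (hα4 : 0 ≤ α4) (hε : 0 ≤ ε)
    (hτbar : 0 ≤ τbar) (ha₁ : 0 ≤ a₁)
    (hliplb : α4 * 2 ^ (ν + 1 + 2 ^ ν) ≤ lip) (hlipb : lip ≤ lipbar)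
    (hsmall : 2 * (((D : ℝ) + 1) * ε * Real.exp (a'' * (ν + 1) + 2 ^ ν * a₁) * 2 ^ (ν + 1 + 2 ^ ν)) ≤ a₁)
    (hfade : ω + 4 * lipbar * (a₁ * Real.exp (-(a'' * (ν + 1)))) * τbar < 1) :
    8 * ((D : ℝ) + 1) * (2 ^ (ν + 1 + 2 ^ ν)) ^ 2 * α4 * ε * τbar < 1 - ω := by
  have h := fadingProduct_lb_lin hα4 hε hτbar hliplb hlipb hsmall
  have hE : 1 ≤ Real.exp (2 ^ ν * a₁) := Real.one_le_exp (by positivity)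
  have hc : 0 ≤ 8 * ((D : ℝ) + 1) * (2 ^ (ν + 1 + 2 ^ ν)) ^ 2 * α4 * ε * τbar := by positivity
  have hmono : 8 * ((D : ℝ) + 1) * (2 ^ (ν + 1 + 2 ^ ν)) ^ 2 * α4 * ε * τbar ≤
      8 * ((D : ℝ) + 1) * (2 ^ (ν + 1 + 2 ^ ν)) ^ 2 * Real.exp (2 ^ ν * a₁) * α4 * ε * τbar := by
    calc 8 * ((D : ℝ) + 1) * (2 ^ (ν + 1 + 2 ^ ν)) ^ 2 * α4 * ε * τbar
        = (8 * ((D : ℝ) + 1) * (2 ^ (ν + 1 + 2 ^ ν)) ^ 2 * α4 * ε * τbar) * 1 := (mul_one _).symm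
      _ ≤ (8 * ((D : ℝ) + 1) * (2 ^ (ν + 1 + 2 ^ ν)) ^ 2 * α4 * ε * τbar) * Real.exp (2 ^ ν * a₁) :=
          mul_le_mul_of_nonneg_left hE hc
      _ = 8 * ((D : ℝ) + 1) * (2 ^ (ν + 1 + 2 ^ ν)) ^ 2 * Real.exp (2 ^ ν * a₁) * α4 * ε * τbar := by ring
  linarith

/-- **(P′) ON T⁴** (`ν = 4`, `D = 8`): fading requires `72·2^42·α4·ε·τ̄ < 1 − ω` (`2^42 = 4398046511104`; no `κ` anywhere).
[folklore] -/
theorem fade_necessary_lin_T4 {a'' a₁ ε α4 lip lipbar τbar ω : ℝ} (hα4 : 0 ≤ α4) (hε : 0 ≤ ε)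
    (hτbar : 0 ≤ τbar) (ha₁ : 0 ≤ a₁)
    (hliplb : α4 * 2 ^ ((4:ℕ) + 1 + 2 ^ (4:ℕ)) ≤ lip) (hlipb : lip ≤ lipbar)
    (hsmall : 2 * ((((8:ℕ) : ℝ) + 1) * ε * Real.exp (a'' * ((4:ℕ) + 1) + 2 ^ (4:ℕ) * a₁) * 2 ^ ((4:ℕ) + 1 + 2 ^ (4:ℕ))) ≤ a₁)
    (hfade : ω + 4 * lipbar * (a₁ * Real.exp (-(a'' * ((4:ℕ) + 1)))) * τbar < 1) :
    72 * 2 ^ 42 * α4 * ε * τbar < 1 - ω := by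
  have h := fade_necessary_lin (ν := 4) (D := 8) hα4 hε hτbar ha₁ hliplb hlipb hsmall hfade
  have e : (8:ℝ) * (((8:ℕ) : ℝ) + 1) * ((2:ℝ) ^ ((4:ℕ) + 1 + 2 ^ (4:ℕ))) ^ 2 = 72 * 2 ^ 42 := by norm_num
  rw [e] at h
  exact h

/-- `2^42 = 4398046511104` and `72·2^42 = 316659348799488` (the T⁴ pure number of (P′)). [folklore] -/
theorem T4_polynomial_constant : (72:ℝ) * 2 ^ 42 = 316659348799488 := by norm_num

/-- **(P′) SUFFICIENCY — FADING IS NOT AN EXTRA SMALLNESS BEYOND A POLYNOMIAL ONE (kernel).**  Given the KP-type smallness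
`2^{ν+1}·e·(D+1)·2^(ν+1+2^ν)·ε·e^{a″(ν+1)} ≤ 1` — print's own shape «2E₀ε₁C₁α₄⁻¹α₆⁻¹M^q exp C₂κ₁ exp 5κ ≤ 1» ([II] p. 18) with
`ν + 1 = 5` on T⁴ — and the polynomial product condition `8e(D+1)(2^(ν+1+2^ν))²·α4·ε·τ̄ < 1 − ω`, the choices
`a₁ := 2e(D+1)·2^(ν+1+2^ν)·ε·e^{a″(ν+1)}` (so `2^ν·a₁ ≤ 1`), `lip = lipbar := α4·2^(ν+1+2^ν)` satisfy the binders `hsmall`, `hliplb`,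
`hlipb` AND the fading inequality for the envelope `B = a₁·e^{−a″(ν+1)}`.  No `L`-dependent exponent: the break-even
`X(33) < 5 < X(35)` of N2-bis (`breakEven`) ∕ N2-ter §A (`breakEven2`) is gone. [folklore] -/
theorem fade_sufficient_lin {ν D : ℕ} {a'' ε α4 τbar ω : ℝ} (hε : 0 ≤ ε) (hα4 : 0 < α4)
    (hKP : 2 ^ (ν + 1) * Real.exp 1 * ((D : ℝ) + 1) * 2 ^ (ν + 1 + 2 ^ ν) * ε * Real.exp (a'' * (ν + 1)) ≤ 1)
    (hprod : 8 * Real.exp 1 * ((D : ℝ) + 1) * (2 ^ (ν + 1 + 2 ^ ν)) ^ 2 * α4 * ε * τbar < 1 - ω) :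
    ∃ a₁ lip lipbar : ℝ, 0 ≤ a₁ ∧ 0 < lip ∧ lip ≤ lipbar ∧ α4 * 2 ^ (ν + 1 + 2 ^ ν) ≤ lip ∧
      2 * (((D : ℝ) + 1) * ε * Real.exp (a'' * (ν + 1) + 2 ^ ν * a₁) * 2 ^ (ν + 1 + 2 ^ ν)) ≤ a₁ ∧
      ω + 4 * lipbar * (a₁ * Real.exp (-(a'' * (ν + 1)))) * τbar < 1 := by
  set P : ℝ := 2 ^ (ν + 1 + 2 ^ ν) with hP
  have hP0 : 0 < P := by positivity
  set a₁ : ℝ := 2 * Real.exp 1 * ((D : ℝ) + 1) * P * ε * Real.exp (a'' * (ν + 1)) with ha₁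
  refine ⟨a₁, α4 * P, α4 * P, by positivity, by positivity, le_rfl, le_rfl, ?_, ?_⟩
  · -- the KP smallness: `e^{2^ν a₁} ≤ e` because `2^ν·a₁ ≤ 1` by `hKP`
    have h1 : 2 ^ ν * a₁ ≤ 1 := by
      have e1 : 2 ^ ν * a₁ = 2 ^ (ν + 1) * Real.exp 1 * ((D : ℝ) + 1) * P * ε * Real.exp (a'' * (ν + 1)) := by
        rw [ha₁]; ring
      rw [e1]; exact hKP
    have h2 : Real.exp (a'' * (ν + 1) + 2 ^ ν * a₁) ≤ Real.exp (a'' * (ν + 1)) * Real.exp 1 := by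
      rw [← Real.exp_add]; exact Real.exp_le_exp.2 (by linarith)
    have hc : 0 ≤ 2 * (((D : ℝ) + 1) * ε) * P := by positivity
    calc 2 * (((D : ℝ) + 1) * ε * Real.exp (a'' * (ν + 1) + 2 ^ ν * a₁) * P)
        = (2 * (((D : ℝ) + 1) * ε) * P) * Real.exp (a'' * (ν + 1) + 2 ^ ν * a₁) := by ring
      _ ≤ (2 * (((D : ℝ) + 1) * ε) * P) * (Real.exp (a'' * (ν + 1)) * Real.exp 1) :=
          mul_le_mul_of_nonneg_left h2 hc
      _ = a₁ := by rw [ha₁]; ring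
  · -- the fading inequality: `4·(α4 P)·(a₁ e^{−a″(ν+1)})·τ̄ = 8e(D+1)P²·α4·ε·τ̄ < 1 − ω`
    have e1 : a₁ * Real.exp (-(a'' * (ν + 1))) = 2 * Real.exp 1 * ((D : ℝ) + 1) * P * ε := by
      have : Real.exp (a'' * (ν + 1)) * Real.exp (-(a'' * (ν + 1))) = 1 := by
        rw [← Real.exp_add, add_neg_cancel, Real.exp_zero]
      calc a₁ * Real.exp (-(a'' * (ν + 1)))
          = 2 * Real.exp 1 * ((D : ℝ) + 1) * P * ε * (Real.exp (a'' * (ν + 1)) * Real.exp (-(a'' * (ν + 1)))) := by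
            rw [ha₁]; ring
        _ = 2 * Real.exp 1 * ((D : ℝ) + 1) * P * ε := by rw [this, mul_one]
    rw [e1]
    have e2 : 4 * (α4 * P) * (2 * Real.exp 1 * ((D : ℝ) + 1) * P * ε) * τbar =
        8 * Real.exp 1 * ((D : ℝ) + 1) * P ^ 2 * α4 * ε * τbar := by ring
    rw [e2]
    linarith

/-- **THE TWO SMALLNESS SHAPES OF (P′) ON T⁴ AS PURE NUMBERS**: the KP-type one reads `288e·2^21·ε·e^{5a″} ≤ 1`
(`2^5·9 = 288`; exponent `5 = ν + 1`, print's «exp 5κ»), the product one `72e·2^42·α4·ε·τ̄ < 1 − ω`. [folklore] -/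
theorem T4_smallness_shapes :
    (2:ℝ) ^ ((4:ℕ) + 1) * (((8:ℕ) : ℝ) + 1) * 2 ^ ((4:ℕ) + 1 + 2 ^ (4:ℕ)) = 288 * 2 ^ 21 ∧
      (8:ℝ) * (((8:ℕ) : ℝ) + 1) * ((2:ℝ) ^ ((4:ℕ) + 1 + 2 ^ (4:ℕ))) ^ 2 = 72 * 2 ^ 42 ∧ (((4:ℕ) : ℝ) + 1) = 5 := by
  refine ⟨by norm_num, by norm_num, by norm_num⟩

end Summit.QuantumFields.BalabanUV.T4Continuum.NE9LinSizeCurrencyBudgetKP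

end
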